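import Literature.MathematicalPhysics.QuantumLattice.PairCorrelations
import HarnessLib

/-!
# Pair correlations: `d`-wave ODLRO implies ODLRO (proof)

Trunk T-QLATTICE, family `hubbard` (companion of
`Literature.MathematicalPhysics.QuantumLattice.PairCorrelations`, which defines the
`ρ₂`-eigenvector form `HasDWaveODLRO` of `d`-wave off-diagonal long-range order and states the
named fact `HasDWaveODLRO.hasODLRO`; this file only PROVES — it declares no definition).

## Contents

* the discharge **`HasDWaveODLRO.hasODLRO_holds`** of the named fact `HasDWaveODLRO.hasODLRO`:
  `HasDWaveODLRO N ψ → HasODLRO N ψ` (Wave0's variational ODLRO of Yang).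

## Proof

`HasDWaveODLRO` asks, eventually in `L`, for a unit pair wavefunction `v` on the torus of side
`L + 1` which is `B₁g`-symmetric and has Rayleigh quotient `re ⟨v, ρ₂(ψ_{L+1}) v⟩ ≥ c N (L+1)`;
`HasODLRO` asks for the same at side `L` without the symmetry constraint. Forget the constraint
and shift the eventual range from sides `L + 1` to sides `L` (`Filter.map_add_atTop_eq_nat`:
the image of `atTop` under `L ↦ L + 1` is `atTop`).

## Sources

C. N. Yang, *Concept of off-diagonal long-range order and the quantum phases of liquid He and of
superconductors*, Rev. Mod. Phys. 34 (1962) 694, §4 (ODLRO of `ρ₂`: a largest eigenvalue of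
order `N`); D. J. Scalapino, Phys. Rep. 250 (1995) 329, §2 (the `d_{x²-y²}` channel).
-/

noncomputable section

namespace Literature.MathematicalPhysics.QuantumLattice

open Matrix Finset Filter Literature.Probability.LatticeModels
open scoped ComplexOrder

/-- **Discharge of the named fact `HasDWaveODLRO.hasODLRO`**: the `B₁g`-restricted Yang criterion
`HasDWaveODLRO N ψ` implies Wave0's `HasODLRO N ψ` (forget the symmetry constraint on the pair
wavefunction and shift the eventual range of sides `L + 1 ↦ L` by `Filter.map_add_atTop_eq_nat`).
Yang, Rev. Mod. Phys. 34 (1962) 694, §4. [cite: Yang1962, §4] -/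
theorem HasDWaveODLRO.hasODLRO_holds : HasDWaveODLRO.hasODLRO := by
  intro N ψ h
  obtain ⟨hnorm, hN, c, hc, hev⟩ := h
  refine ⟨hnorm, hN, c, hc, ?_⟩
  have h1 : ∀ᶠ b : ℕ in Filter.map (fun a : ℕ => a + 1) atTop,
      ∃ v : Orb (FermionTorus 2 b) × Orb (FermionTorus 2 b) → ℂ,
        star v ⬝ᵥ v = 1 ∧ c * N b ≤ (star v ⬝ᵥ (twoParticleRDM (ψ b) *ᵥ v)).re :=
    Filter.eventually_map.2 (hev.mono fun L ⟨v, hv, _, hb⟩ => ⟨v, hv, hb⟩)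
  rwa [Filter.map_add_atTop_eq_nat] at h1

end Literature.MathematicalPhysics.QuantumLattice
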